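import Mathlib
import Literature.MathematicalPhysics.QuantumFieldTheory.BalabanImbrieJaffe1984to88.BIJ85Eq7117FibreMinFree
import Literature.MathematicalPhysics.QuantumFieldTheory.BalabanImbrieJaffe1984to88.BIJ85Eq7112SymbolFibreMin
import Literature.MathematicalPhysics.QuantumFieldTheory.BalabanImbrieJaffe1984to88.BIJ85Tau1Config717
import Literature.MathematicalPhysics.QuantumFieldTheory.BalabanImbrieJaffe1984to88.BIJ85SigmaTranslationInvariance
import Literature.MathematicalPhysics.QuantumFieldTheory.BalabanImbrieJaffe1984to88.BIJ85Sigma422Equivariance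

/-!
# `BalabanImbrieJaffe1984to88.BIJ85Eq7117Tau1Symbol` — T. Bałaban, J. Imbrie, A. Jaffe, *Renormalization of the Higgs model: minimizers,
propagators and the stability of mean field theory*, Commun. Math. Phys. **97** (1985) 299–329 [BalabanImbrieJaffe1985]: Sect. 7.1 p. 323
(7.1.17) — **THE MULTIPLICATION OPERATOR `τ₁(p)` OF THE τ₁ OF RECORD IS HALF THE UNCONSTRAINED FIBRE MINIMUM**: for seat p33's
configuration-space `τ₁ = Q^e_k(I − P_∂)Q^{e*}_k` on the tori (`BIJ85Tau1Config717.tau1Torus`, the `Setup` carriers; weight `η^d`, any curl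
factor `c ≠ 0`) (i) *"τ₁ is translation invariant"*: `τ₁(τ_tf) = τ_t(τ₁f)` (the orthogonal projection `P_∂` onto curls commutes with the
lattice translations because `∂` and `Q^{e*}_k` do — p33's `curlOp_bondTransl`/`QesOp_unitPlaqTransl`), so `τ₁` has a momentum symbol `τ₁(p′)
= symb tau1Matrix p′` in the sense of (7.1.2); (ii) **`⟨ψ, τ₁(p′)ψ⟩ = ½·m°_{p′}(ψ^asym)` at EVERY dual momentum `p′`**, `m°` = file 1's
UNCONSTRAINED fibre minimum `fibreMinU (L^k) (Mk P k)`; (iii) `⟨f, τ₁f⟩ = ½·Σ_{p′} m°_{p′}(f̂(p′))` and `σ_k − τ₁ = τ₂` at the matrix level —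
file 2 of 3 of the separate identification of τ₁/τ₂ (file 3 `BIJ85Eq7114Tau1Identification`: `½·m°_{p′} = τ₁(p′)` of (7.1.14), hence
`τ₂(p′)` of (7.1.15), at generic momenta)

statement-level skeleton of published theorems with citation tags; proofs where landed; nothing here is a claim about
the Yang–Mills mass gap

PDF held: `paper:balaban1985-cmp97-bij-higgs-minimizers` (journal page = PDF page + 298).  Text read as images: PDF pp. 23–25 (journal
321–323; `run/shared/lean/pub/pub-balaban/t4/b2b-balaban-t4-lit2/renders/bij1985/1985-cmp97-bij-higgs-minimizers-p023-x2.png` … `-p025-x2.png`).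

THE PRINTED TEXT (verbatim).  p. 321: *"Since we study periodic boundary conditions, σ_k is translation invariant. Thus it is natural to
study σ_k as a multiplication operator σ_k(p) in the Fourier transform representation."*; p. 322–323: *"We express σ_k as a sum of two terms
σ_k = τ₁ + τ₂. (7.1.13) Here τ₁ vanishes on curls. … The general form of τ₁ in configuration space is evident from (7.1.11), (7.1.14)
namely τ₁ = Q^e_k(I − P_∂)Q^{e*}_k, (7.1.17) where P_∂ denotes the orthogonal projection onto curls."*

CITATION HEADER (lean-in-tree rule).  Part of the lit-balaban TYPED SKELETON (HOME `run/shared/lean/pub/lit-balaban/`), Phase-2 seat p27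
(gen 6), unit `lit-balaban-p27`; rows **C1.Eq7.1.13-7.1.19**, **C1.Eq7.1.2-7.1.12** of `HOME/SKELETON.md` (owner r15, referee ref-5).  INPUTS
(all landed, by name): p33 `BIJ85Tau1Config717` (`projCurl`, `tau1Op`, `tau1Torus`, `tau2Torus`, `sigmaTorus_eq_tau1_add_tau2`, `tau1Op_symm`,
`inner_tau1Torus_le`, `exists_eq_inner_tau1Torus`, `inner_tau1Torus_eq_iInf`), p33 `BIJ85SigmaTranslationInvariance` (`bondTransl`, `plaqTransl`,
`unitPlaqTransl`, `curlOp_bondTransl`, `QesOp_unitPlaqTransl`, `unitPlaqTransl_single`), p33 `BIJ85Sigma712Torus` (`plaqEquiv`, `cvec`,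
`sigmaMatrix`), gen 4's `BIJ85Sigma422Equivariance.adjoint_intertwine` and `BIJ85Eq712Plancherel` (`symb`, `eq712`), p30
`BIJ85SigmaTorusScaling.curlOp_eq_smul`, this generation's `BIJ85Eq7112SymbolFibreMin` (`AR`, `AC_AR`, `reP_fC`, `energy421_AC_fC`, `uRe`/`uIm`,
`asymO`, `mode`, `fC_eq_asym_cvec`, `dftC_mulVec_asym`) and `BIJ85Eq7117FibreMinFree` (`fibreMinU`, `iInf_energy421_eq_sum_fibreMinU`,
`iInf_energy421_eq_reP_add_imP_free`).
WHAT IS KERNEL-CHECKED (zero `sorry`, standard axioms; bookkeeping defs `opMatrix` (matrix of an operator on `UnitPlaqSpace` in the plaquette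
basis, on p27's carrier; `opMatrix (sigmaTorus) = sigmaMatrix` by `rfl`), `tau1Matrix`, `tau2Matrix` with bodies; no `def … : Prop`, no new
named fact, D-0026): §1 `projCurl_equivariant`, **`tau1Op_equivariant`** (abstract); §2 **`tau1Torus_translate`**, `opMatrix`/`form_opMatrix`/
`opMatrix_add`/`opMatrix_isTranslInv_of`, `tau1Matrix_isTranslInv`, `sigmaMatrix_eq_tau1Matrix_add_tau2Matrix`, `tau2Matrix_isTranslInv`;
§3 `curlOp_toE_smul`, `inner_tau1Torus_indep_c`, `two_mul_inner_tau1Torus_le_energy421`, **`two_mul_inner_tau1Torus_eq_iInf`**,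
**`inner_tau1Torus_eq_half_sum_fibreMinU`**; §4 `form_opMatrix_complex`, `form_tau1Matrix_eq_half_iInf`, **`symb_tau1Matrix_form_eq_half_fibreMinU`**.
HONEST SCOPE: the closed form (7.1.14) of `m°` is file 3; nothing here about the axial gauge (τ₁ involves no constraint).
-/

namespace Literature.MathematicalPhysics.QuantumFieldTheory.BalabanImbrieJaffe1984to88.BIJ85Eq7117Tau1Symbol

open scoped BigOperators RealInnerProductSpace Matrix ComplexConjugate
open Literature.MathematicalPhysics.QuantumFieldTheory.Balaban1983to89
open B5Prop11Plancherel (Tor fine)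
open B5Block118 (QvOp)
open B5Eq117TorusCarriers (Mk)
open BIJ85Eq712Plancherel (dftC symb IsTranslInv eq712 dftC_mul_star)
open BIJ85Sigma712Torus (Orient torN plaqEquiv plaqEquiv_symm_apply plaqEquiv_symm_add cvec cvec_apply sigmaMatrix sigmaMatrix_apply)
open BIJ85Thm711TorusTransport (asym fC AC)
open BIJ85Thm711Torus (eta_pow_d_pos)
open BIJ85SigmaTranslationInvariance (bondTransl plaqTransl unitPlaqTransl curlOp_bondTransl QesOp_unitPlaqTransl unitPlaqTransl_single)
open BIJ85Sigma422Equivariance (adjoint_intertwine)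
open BIJ85Tau1Config717 (projCurl projCurl_apply projCurl_mem_range inner_sub_projCurl_curl tau1Op tau1Torus tau2Torus
  sigmaTorus_eq_tau1_add_tau2 tau1Op_symm inner_tau1Torus_le exists_eq_inner_tau1Torus inner_tau1Torus_eq_iInf)
open BIJ85SigmaTorusScaling (curlOp_eq_smul)
open BIJ85AxialPropagator411 BIJ85SigmaForm421 BIJ85Sigma421Torus
open BIJ85Eq7112FibreMin BIJ85Eq7112FibreMinReal BIJ85Eq7112SymbolFibreMin BIJ85Eq7117FibreMinFree

noncomputable section

/-! ## §1 `P_∂` and `τ₁` are equivariant under isometric symmetries of `(∂, Q^{e*}_k)` -/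

section Abstract

variable {E F F' : Type*} [NormedAddCommGroup E] [InnerProductSpace ℝ E] [FiniteDimensional ℝ E]
  [NormedAddCommGroup F] [InnerProductSpace ℝ F] [FiniteDimensional ℝ F]
  [NormedAddCommGroup F'] [InnerProductSpace ℝ F'] [FiniteDimensional ℝ F']

omit [FiniteDimensional ℝ F] in
/-- **`P_∂` commutes with every isometric symmetry of `∂`**: if `∂U_E = U_F∂` for linear isometries `U_E`, `U_F`, then `P_∂U_F = U_FP_∂`
(*"P_∂ denotes the orthogonal projection onto curls"*; `U_F(P_∂g)` is a curl and `U_Fg − U_F(P_∂g) ⊥ range ∂`). [cite: BalabanImbrieJaffe1985, (7.1.17) p.323] -/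
theorem projCurl_equivariant (D : E →ₗ[ℝ] F) (UE : E ≃ₗᵢ[ℝ] E) (UF : F ≃ₗᵢ[ℝ] F) (hD : ∀ A, D (UE A) = UF (D A)) (g : F) :
    projCurl D (UF g) = UF (projCurl D g) := by
  obtain ⟨A₀, hA₀⟩ := LinearMap.mem_range.mp (projCurl_mem_range D g)
  rw [projCurl_apply]
  refine Submodule.eq_starProjection_of_mem_orthogonal ?_ ?_
  · rw [← hA₀, ← hD]
    exact LinearMap.mem_range_self D (UE A₀)
  · refine (Submodule.mem_orthogonal' _ _).2 fun u hu => ?_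
    obtain ⟨A, rfl⟩ := LinearMap.mem_range.mp hu
    have hA : D A = UF (D (UE.symm A)) := by rw [← hD, LinearIsometryEquiv.apply_symm_apply]
    rw [← map_sub, hA, LinearIsometryEquiv.inner_map_map]
    exact inner_sub_projCurl_curl D g (UE.symm A)

/-- **`τ₁ = Q^e_k(I − P_∂)Q^{e*}_k` is equivariant**: `τ₁(Uf) = U(τ₁f)` whenever `∂U_E = U_F∂` and `Q^{e*}_kU = U_FQ^{e*}_k` for linear
isometries (the abstract form of *"σ_k is translation invariant"* for the τ₁ part). [cite: BalabanImbrieJaffe1985, (7.1.17) p.323] -/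
theorem tau1Op_equivariant (D : E →ₗ[ℝ] F) (Qes : F' →ₗ[ℝ] F) (UE : E ≃ₗᵢ[ℝ] E) (UF : F ≃ₗᵢ[ℝ] F) (U : F' ≃ₗᵢ[ℝ] F')
    (hD : ∀ A, D (UE A) = UF (D A)) (hQ : ∀ f, Qes (U f) = UF (Qes f)) (f : F') :
    tau1Op D Qes (U f) = U (tau1Op D Qes f) := by
  simp only [tau1Op, LinearMap.comp_apply, LinearMap.sub_apply, LinearMap.id_apply]
  rw [hQ, projCurl_equivariant D UE UF hD, ← map_sub,
    adjoint_intertwine Qes U UF hQ (Qes f - projCurl D (Qes f))]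

end Abstract

/-! ## §2 On the tori: `τ₁` is translation invariant; the matrices of `τ₁`, `τ₂` on p27's carrier -/

section Torus

variable {P : Params} {k : ℕ}

/-- **`τ₁(τ_tf) = τ_t(τ₁f)` ON THE TORUS** for every `t ∈ T^{(k)}` (p33's `tau1Torus`; standing range `k ≤ m + K`, any `w`, `c`).
[cite: BalabanImbrieJaffe1985, (7.1.17) p.323] -/
theorem tau1Torus_translate (hd : 2 ≤ P.d) (hk : k ≤ P.m + P.K) (w c : ℝ) (t : Balaban1983to89.Site P k) (f : UnitPlaqSpace P k) :
    tau1Torus hd w c k (unitPlaqTransl k t f) = unitPlaqTransl k t (tau1Torus hd w c k f) :=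
  tau1Op_equivariant (curlOp (P := P) w c) (QesOp (P := P) hd w k) (bondTransl (Site.scaleTo k t)) (plaqTransl (Site.scaleTo k t))
    (unitPlaqTransl k t) (curlOp_bondTransl w c (Site.scaleTo k t)) (QesOp_unitPlaqTransl hd hk w t) f

/-- **The matrix of an operator on `T₁^{(k)}`-plaquette fields in the plaquette basis, on p27's carrier `Tor × Orient`**:
`T((x,i),(y,j)) = ⟨δ_{(x,i)}, Tδ_{(y,j)}⟩` (p33's `sigmaMatrix` is `opMatrix (sigmaTorus …)`). [cite: BalabanImbrieJaffe1985, (7.1.2) p.321] -/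
def opMatrix (k : ℕ) (T : UnitPlaqSpace P k →ₗ[ℝ] UnitPlaqSpace P k) :
    Matrix (Tor (torN P k) × Orient P) (Tor (torN P k) × Orient P) ℂ :=
  Matrix.of fun a b => ((⟪EuclideanSpace.single ((plaqEquiv P k).symm a) (1 : ℝ),
    T (EuclideanSpace.single ((plaqEquiv P k).symm b) (1 : ℝ))⟫ : ℝ) : ℂ)

/-- Entries of `opMatrix`. [cite: BalabanImbrieJaffe1985, (7.1.2) p.321] -/
theorem opMatrix_apply (T : UnitPlaqSpace P k →ₗ[ℝ] UnitPlaqSpace P k) (a b : Tor (torN P k) × Orient P) :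
    opMatrix k T a b = ((⟪EuclideanSpace.single ((plaqEquiv P k).symm a) (1 : ℝ),
      T (EuclideanSpace.single ((plaqEquiv P k).symm b) (1 : ℝ))⟫ : ℝ) : ℂ) := rfl

/-- p33's `sigmaMatrix` is the `opMatrix` of `sigmaTorus`. [cite: BalabanImbrieJaffe1985, (7.1.2) p.321] -/
theorem opMatrix_sigmaTorus (hd : 2 ≤ P.d) (w c : ℝ) (k : ℕ) :
    opMatrix k (sigmaTorus (P := P) hd w c k) = sigmaMatrix hd w c k := rfl

/-- `opMatrix` is additive in the operator. [cite: BalabanImbrieJaffe1985, (7.1.13) p.322] -/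
theorem opMatrix_add (S T : UnitPlaqSpace P k →ₗ[ℝ] UnitPlaqSpace P k) : opMatrix k (S + T) = opMatrix k S + opMatrix k T := by
  ext a b
  rw [Matrix.add_apply, opMatrix_apply, opMatrix_apply, opMatrix_apply, LinearMap.add_apply, inner_add_right, Complex.ofReal_add]

/-- **The matrix of `τ₁`** on p27's carrier. [cite: BalabanImbrieJaffe1985, (7.1.17) p.323] -/
def tau1Matrix (hd : 2 ≤ P.d) (w c : ℝ) (k : ℕ) : Matrix (Tor (torN P k) × Orient P) (Tor (torN P k) × Orient P) ℂ :=
  opMatrix k (tau1Torus (P := P) hd w c k)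

/-- **The matrix of `τ₂`** on p27's carrier. [cite: BalabanImbrieJaffe1985, (7.1.13) p.322] -/
def tau2Matrix (hd : 2 ≤ P.d) (w c : ℝ) (k : ℕ) : Matrix (Tor (torN P k) × Orient P) (Tor (torN P k) × Orient P) ℂ :=
  opMatrix k (tau2Torus (P := P) hd w c k)

/-- **(7.1.13) at the matrix level**: `sigmaMatrix = tau1Matrix + tau2Matrix`. [cite: BalabanImbrieJaffe1985, (7.1.13) p.322] -/
theorem sigmaMatrix_eq_tau1Matrix_add_tau2Matrix (hd : 2 ≤ P.d) (w c : ℝ) (k : ℕ) :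
    sigmaMatrix hd w c k = tau1Matrix (P := P) hd w c k + tau2Matrix hd w c k := by
  rw [← opMatrix_sigmaTorus, sigmaTorus_eq_tau1_add_tau2, opMatrix_add]
  rfl

/-- kernel: on a real Euclidean space, `⟨f, Tg⟩ = Σ_p Σ_q f_p ⟨δ_p, Tδ_q⟩ g_q`. [folklore] -/
private theorem inner_eq_sum_single' {ι : Type*} [Fintype ι] [DecidableEq ι] (T : EuclideanSpace ℝ ι →ₗ[ℝ] EuclideanSpace ℝ ι)
    (f g : EuclideanSpace ℝ ι) :
    ⟪f, T g⟫ = ∑ p, ∑ q, f p * ⟪EuclideanSpace.single p (1 : ℝ), T (EuclideanSpace.single q (1 : ℝ))⟫ * g q := by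
  have hrepr : ∀ v : EuclideanSpace ℝ ι, v = ∑ q, v q • EuclideanSpace.single q (1 : ℝ) := by
    intro v
    conv_lhs => rw [← (EuclideanSpace.basisFun ι ℝ).sum_repr v]
    simp only [EuclideanSpace.basisFun_repr, EuclideanSpace.basisFun_apply]
  conv_lhs => rw [hrepr f, hrepr g]
  simp only [map_sum, map_smul, sum_inner, inner_sum, real_inner_smul_left, real_inner_smul_right]
  rw [Finset.sum_comm]
  refine Finset.sum_congr rfl fun p _ => Finset.sum_congr rfl fun q _ => ?_
  ring

/-- **p27's form is the operator's form**: `star f̃ ⬝ᵥ (opMatrix T *ᵥ g̃) = ⟨f, Tg⟩` for real plaquette fields `f, g`.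
[cite: BalabanImbrieJaffe1985, (7.1.2) p.321] -/
theorem form_opMatrix (T : UnitPlaqSpace P k →ₗ[ℝ] UnitPlaqSpace P k) (f g : UnitPlaqSpace P k) :
    star (cvec k f) ⬝ᵥ (opMatrix k T *ᵥ cvec k g) = ((⟪f, T g⟫ : ℝ) : ℂ) := by
  classical
  rw [inner_eq_sum_single']
  push_cast
  simp only [dotProduct, Matrix.mulVec, cvec_apply, opMatrix_apply, Pi.star_apply, Complex.star_def, Complex.conj_ofReal, Finset.mul_sum]
  symm
  refine Fintype.sum_equiv (plaqEquiv P k) _ _ fun p => ?_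
  refine Fintype.sum_equiv (plaqEquiv P k) _ _ fun q => ?_
  simp only [Equiv.symm_apply_apply]
  ring

/-- kernel: `(p + t) − t = p` for plaquettes. [folklore] -/
private theorem translate_translate_neg' (t : Balaban1983to89.Site P k) (p : Plaq P k) : (p.translate t).translate (-t) = p := by
  obtain ⟨x, μ, ν, h⟩ := p
  simp [Plaq.translate]

/-- **A translation-equivariant operator has a translation-invariant matrix** (the shape `IsTranslInv` of (7.1.2)): `T(τ_tf) = τ_t(Tf)` for
all `t` ⟹ `T((x+a,i),(y+a,j)) = T((x,i),(y,j))`. [cite: BalabanImbrieJaffe1985, (7.1.2) p.321] -/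
theorem opMatrix_isTranslInv_of (T : UnitPlaqSpace P k →ₗ[ℝ] UnitPlaqSpace P k)
    (hT : ∀ (t : Balaban1983to89.Site P k) (f : UnitPlaqSpace P k), T (unitPlaqTransl k t f) = unitPlaqTransl k t (T f)) :
    IsTranslInv (torN P k) (Orient P) (opMatrix k T) := by
  classical
  intro a x y i j
  rw [opMatrix_apply, opMatrix_apply, plaqEquiv_symm_add, plaqEquiv_symm_add]
  set p := (plaqEquiv P k).symm (x, i)
  set q := (plaqEquiv P k).symm (y, j)
  have hp : unitPlaqTransl k a (EuclideanSpace.single (p.translate a) (1 : ℝ)) = EuclideanSpace.single p 1 := by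
    rw [unitPlaqTransl_single, translate_translate_neg']
  have hq : unitPlaqTransl k a (EuclideanSpace.single (q.translate a) (1 : ℝ)) = EuclideanSpace.single q 1 := by
    rw [unitPlaqTransl_single, translate_translate_neg']
  rw [← hp, ← hq, hT, LinearIsometryEquiv.inner_map_map]

/-- **`τ₁` is translation invariant** in p27's sense (`IsTranslInv tau1Matrix`; standing range). [cite: BalabanImbrieJaffe1985, (7.1.17) p.323] -/
theorem tau1Matrix_isTranslInv (hd : 2 ≤ P.d) (hk : k ≤ P.m + P.K) (w c : ℝ) :
    IsTranslInv (torN P k) (Orient P) (tau1Matrix (P := P) hd w c k) :=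
  opMatrix_isTranslInv_of _ fun t f => tau1Torus_translate hd hk w c t f

/-- … hence so is `τ₂ = σ_k − τ₁` (`w > 0`, `c ≠ 0` for σ_k). [cite: BalabanImbrieJaffe1985, (7.1.13) p.322] -/
theorem tau2Matrix_isTranslInv (hd : 2 ≤ P.d) (hk : k ≤ P.m + P.K) {w : ℝ} (hw : 0 < w) {c : ℝ} (hc : c ≠ 0) :
    IsTranslInv (torN P k) (Orient P) (tau2Matrix (P := P) hd w c k) := by
  have h : tau2Matrix (P := P) hd w c k = sigmaMatrix hd w c k - tau1Matrix hd w c k := by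
    rw [sigmaMatrix_eq_tau1Matrix_add_tau2Matrix, add_sub_cancel_left]
  intro a x y i j
  rw [h, Matrix.sub_apply, Matrix.sub_apply, BIJ85Sigma712Torus.sigmaMatrix_isTranslInv hd hk hw hc a x y i j,
    tau1Matrix_isTranslInv hd hk w c a x y i j]

/-! ## §3 `⟨f, τ₁f⟩` is half the UNCONSTRAINED `Tor` infimum, hence half the sum of the unconstrained fibre minima -/

/-- kernel: `L^k ≠ 0` in `ℝ`. [folklore] -/
private theorem Lk_ne_zero' (P : Params) (k : ℕ) : ((P.L : ℝ) ^ k) ≠ 0 := pow_ne_zero _ (Nat.cast_ne_zero.2 P.L_pos.ne')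

/-- Changing the curl factor is a rescaling of the η-bond field: `curlOp w c (toE A) = curlOp w c′ (toE ((c/c′)•A))` (`c′ ≠ 0`; p30's
`curlOp_eq_smul`). [cite: BalabanImbrieJaffe1985, (4.2.1) p.310] -/
theorem curlOp_toE_smul (w c : ℝ) {c' : ℝ} (hc' : c' ≠ 0) (A : VecField P 0 ℝ) :
    curlOp (P := P) w c (toE P A) = curlOp (P := P) w c' (toE P ((c / c') • A)) := by
  rw [map_smul, map_smul, curlOp_eq_smul w c, curlOp_eq_smul w c', LinearMap.smul_apply, LinearMap.smul_apply, smul_smul]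
  congr 1
  field_simp

/-- **`⟨f, τ₁f⟩` does not depend on the curl factor** (`c, c′ ≠ 0`): the unconstrained infimum is invariant under `A ↦ (c/c′)A`.
[cite: BalabanImbrieJaffe1985, (7.1.17) p.323] -/
theorem inner_tau1Torus_indep_c (hd : 2 ≤ P.d) (w : ℝ) {c c' : ℝ} (hc : c ≠ 0) (hc' : c' ≠ 0) (k : ℕ) (f : UnitPlaqSpace P k) :
    ⟪f, tau1Torus hd w c k f⟫ = ⟪f, tau1Torus hd w c' k f⟫ := by
  rw [inner_tau1Torus_eq_iInf, inner_tau1Torus_eq_iInf]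
  let e : VecField P 0 ℝ ≃ VecField P 0 ℝ :=
    { toFun := fun A => (c / c') • A
      invFun := fun A => (c' / c) • A
      left_inv := fun A => by
        show (c' / c) • (c / c') • A = A
        rw [smul_smul, show c' / c * (c / c') = 1 by field_simp, one_smul]
      right_inv := fun A => by
        show (c / c') • (c' / c) • A = A
        rw [smul_smul, show c / c' * (c' / c) = 1 by field_simp, one_smul] }
  refine Equiv.iInf_congr e fun A => ?_
  show ‖curlOp (P := P) w c' (toE P ((c / c') • A)) - QesOp (P := P) hd w k f‖ ^ 2 = _
  rw [← curlOp_toE_smul w c hc' A]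

/-- **Every COMPLEX η-field on the `Tor` carrier pays at least `2⟨f, τ₁f⟩` against a real unit field** (no constraint at all):
`2⟨f, τ₁f⟩ ≤ energy421 (L^k) Mk A′ (fC f)` (`τ₁ = tau1Torus hd (η^d) (L^k) k`). [cite: BalabanImbrieJaffe1985, (7.1.17) p.323] -/
theorem two_mul_inner_tau1Torus_le_energy421 (hd : 2 ≤ P.d) (hk : k ≤ P.m + P.K) (f : UnitPlaqSpace P k)
    (A' : Tor (fine (P.L ^ k) (Mk P k)) × Fin P.d → ℂ) :
    2 * ⟪f, tau1Torus hd (P.eta k ^ P.d) ((P.L : ℝ) ^ k) k f⟫ ≤ energy421 (P.L ^ k) (Mk P k) A' (fC k fun q => f q) := by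
  have h1 := inner_tau1Torus_le hd (P.eta k ^ P.d) ((P.L : ℝ) ^ k) k f (AR hk A')
  have h2 := energy421_AC_fC hd hk (AR hk A') f
  have h3 := energy421_reP_le (P.L ^ k) (Mk P k) A' (reP_fC (k := k) fun q => f q)
  rw [AC_AR] at h2
  linarith

/-- **The bound is attained** by some (real) η-field. [cite: BalabanImbrieJaffe1985, (7.1.17) p.323] -/
theorem exists_energy421_eq_two_mul_inner_tau1 (hd : 2 ≤ P.d) (hk : k ≤ P.m + P.K) (f : UnitPlaqSpace P k) :
    ∃ A' : Tor (fine (P.L ^ k) (Mk P k)) × Fin P.d → ℂ,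
      energy421 (P.L ^ k) (Mk P k) A' (fC k fun q => f q) = 2 * ⟪f, tau1Torus hd (P.eta k ^ P.d) ((P.L : ℝ) ^ k) k f⟫ := by
  obtain ⟨A, hE⟩ := exists_eq_inner_tau1Torus hd (P.eta k ^ P.d) ((P.L : ℝ) ^ k) k f
  exact ⟨AC hk A, by rw [energy421_AC_fC hd hk A f, hE]⟩

/-- **`2⟨f, τ₁f⟩ = inf over ALL A′ of energy421 A′ (fC f)`** — the form of the τ₁ of record IS the unconstrained infimum of the exponent of
(4.2.1) on the `Tor` carriers (any `c ≠ 0`). [cite: BalabanImbrieJaffe1985, (7.1.17) p.323] -/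
theorem two_mul_inner_tau1Torus_eq_iInf (hd : 2 ≤ P.d) (hk : k ≤ P.m + P.K) {c : ℝ} (hc : c ≠ 0) (f : UnitPlaqSpace P k) :
    2 * ⟪f, tau1Torus hd (P.eta k ^ P.d) c k f⟫
      = ⨅ A' : Tor (fine (P.L ^ k) (Mk P k)) × Fin P.d → ℂ, energy421 (P.L ^ k) (Mk P k) A' (fC k fun q => f q) := by
  rw [inner_tau1Torus_indep_c hd _ hc (Lk_ne_zero' P k)]
  apply le_antisymm
  · exact le_ciInf fun A' => two_mul_inner_tau1Torus_le_energy421 hd hk f A'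
  · obtain ⟨A', hE⟩ := exists_energy421_eq_two_mul_inner_tau1 hd hk f
    exact (iInf_energy421_le_free _ _ A' _).trans_eq hE

/-- **`⟨f, τ₁f⟩ = ½·Σ_{p′} m°_{p′}(f̂(p′))`** (file 1's `iInf_energy421_eq_sum_fibreMinU`). [cite: BalabanImbrieJaffe1985, (7.1.17) p.323] -/
theorem inner_tau1Torus_eq_half_sum_fibreMinU (hd : 2 ≤ P.d) (hk : k ≤ P.m + P.K) {c : ℝ} (hc : c ≠ 0) (f : UnitPlaqSpace P k) :
    ⟪f, tau1Torus hd (P.eta k ^ P.d) c k f⟫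
      = (1 / 2 : ℝ) * ∑ q : Tor (Mk P k), fibreMinU (P.L ^ k) (Mk P k) q
          (fun a => (dftC (Mk P k) (Fin P.d × Fin P.d) *ᵥ fC k fun q => f q) (q, a)) := by
  rw [← iInf_energy421_eq_sum_fibreMinU, ← two_mul_inner_tau1Torus_eq_iInf hd hk hc f]
  ring

/-! ## §4 Complex fields and the symbol: `⟨ψ, τ₁(p′)ψ⟩ = ½·m°_{p′}(ψ^asym)` -/

/-- **The complex form of a real symmetric operator splits**: `star F ⬝ᵥ (opMatrix T *ᵥ F) = ⟨u, Tu⟩ + ⟨v, Tv⟩`, `u = Re F`, `v = Im F`.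
[cite: BalabanImbrieJaffe1985, (7.1.2) p.321] -/
theorem form_opMatrix_complex (T : UnitPlaqSpace P k →ₗ[ℝ] UnitPlaqSpace P k) (hT : ∀ f g, ⟪T f, g⟫ = ⟪f, T g⟫)
    (F : Tor (torN P k) × Orient P → ℂ) :
    star F ⬝ᵥ (opMatrix k T *ᵥ F) = (((⟪uRe k F, T (uRe k F)⟫ + ⟪uIm k F, T (uIm k F)⟫ : ℝ)) : ℂ) := by
  have hF : F = cvec k (uRe k F) + Complex.I • cvec k (uIm k F) := by
    rw [cvec_uRe, cvec_uIm, reP_add_I_smul_imP]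
  have hcross : star (cvec k (uRe k F)) ⬝ᵥ (opMatrix k T *ᵥ cvec k (uIm k F))
      = star (cvec k (uIm k F)) ⬝ᵥ (opMatrix k T *ᵥ cvec k (uRe k F)) := by
    rw [form_opMatrix, form_opMatrix, ← hT, real_inner_comm]
  conv_lhs => rw [hF]
  rw [Matrix.mulVec_add, Matrix.mulVec_smul, star_add, star_smul, add_dotProduct, dotProduct_add, dotProduct_add, smul_dotProduct,
    smul_dotProduct, dotProduct_smul, dotProduct_smul, hcross, form_opMatrix T (uRe k F) (uRe k F),
    form_opMatrix T (uIm k F) (uRe k F), form_opMatrix T (uIm k F) (uIm k F), Complex.star_def, Complex.conj_I]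
  simp only [smul_eq_mul]
  push_cast
  linear_combination (-(⟪uIm k F, T (uIm k F)⟫ : ℂ)) * Complex.I_mul_I

/-- **`star F ⬝ᵥ (tau1Matrix *ᵥ F) = ½·inf_A energy421 A F^asym`** for every complex `F` (weight `η^d`, any `c ≠ 0`): §3 for `Re F`, `Im F` +
file 1's real/imaginary splitting. [cite: BalabanImbrieJaffe1985, (7.1.17) p.323] -/
theorem form_tau1Matrix_eq_half_iInf (hd : 2 ≤ P.d) (hk : k ≤ P.m + P.K) {c : ℝ} (hc : c ≠ 0) (F : Tor (torN P k) × Orient P → ℂ) :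
    star F ⬝ᵥ (tau1Matrix hd (P.eta k ^ P.d) c k *ᵥ F)
      = ((((1 / 2 : ℝ) * ⨅ A : Tor (fine (P.L ^ k) (Mk P k)) × Fin P.d → ℂ,
          energy421 (P.L ^ k) (Mk P k) A (asym F) : ℝ)) : ℂ) := by
  have hT : ∀ f g : UnitPlaqSpace P k, ⟪tau1Torus hd (P.eta k ^ P.d) c k f, g⟫ = ⟪f, tau1Torus hd (P.eta k ^ P.d) c k g⟫ :=
    fun f g => tau1Op_symm _ _ f g
  rw [tau1Matrix, form_opMatrix_complex _ hT, iInf_energy421_eq_reP_add_imP_free, reP_asym, imP_asym, ← cvec_uRe,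
    ← cvec_uIm, ← fC_eq_asym_cvec, ← fC_eq_asym_cvec, ← two_mul_inner_tau1Torus_eq_iInf hd hk hc,
    ← two_mul_inner_tau1Torus_eq_iInf hd hk hc]
  push_cast
  ring

/-- **`star F ⬝ᵥ (tau1Matrix *ᵥ F) = ½·Σ_{p′} m°_{p′}((F̂(p′))^asym)`** for every complex `F`. [cite: BalabanImbrieJaffe1985, (7.1.17) p.323] -/
theorem form_tau1Matrix_eq_half_sum_fibreMinU (hd : 2 ≤ P.d) (hk : k ≤ P.m + P.K) {c : ℝ} (hc : c ≠ 0)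
    (F : Tor (torN P k) × Orient P → ℂ) :
    star F ⬝ᵥ (tau1Matrix hd (P.eta k ^ P.d) c k *ᵥ F)
      = ((((1 / 2 : ℝ) * ∑ q : Tor (Mk P k), fibreMinU (P.L ^ k) (Mk P k) q
          (fun a => asym (dftC (Mk P k) (Orient P) *ᵥ F) (q, a)) : ℝ)) : ℂ) := by
  rw [form_tau1Matrix_eq_half_iInf hd hk hc, iInf_energy421_eq_sum_fibreMinU, dftC_mulVec_asym]

/-- kernel: `(F⊗1)((F⊗1)^* e) = e`. [folklore] -/
private theorem dftC_mulVec_star_mulVec' {N : Fin P.d → ℕ} [∀ μ, NeZero (N μ)] (e : Tor N × Orient P → ℂ) :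
    dftC N (Orient P) *ᵥ (star (dftC N (Orient P)) *ᵥ e) = e := by
  rw [Matrix.mulVec_mulVec, dftC_mul_star, Matrix.one_mulVec]

/-- **THE MULTIPLICATION OPERATOR `τ₁(p′)` IS HALF THE UNCONSTRAINED FIBRE MINIMUM**: for p33's τ₁ of record (weight `η^d`, any curl factor
`c ≠ 0`, `k ≤ m + K`, `2 ≤ d`), at EVERY dual momentum `p′` of `T₁^{(k)}` and every fibre vector `ψ`:
`⟨ψ, τ₁(p′)ψ⟩ = ½·fibreMinU (L^k) (Mk P k) p′ (asymO ψ)`. [cite: BalabanImbrieJaffe1985, (7.1.17) p.323] -/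
theorem symb_tau1Matrix_form_eq_half_fibreMinU (hd : 2 ≤ P.d) (hk : k ≤ P.m + P.K) {c : ℝ} (hc : c ≠ 0)
    (p : Tor (torN P k)) (ψ : Orient P → ℂ) :
    star ψ ⬝ᵥ (symb (torN P k) (Orient P) (tau1Matrix hd (P.eta k ^ P.d) c k) p *ᵥ ψ)
      = ((((1 / 2 : ℝ) * fibreMinU (P.L ^ k) (Mk P k) p (asymO ψ) : ℝ)) : ℂ) := by
  classical
  set F : Tor (torN P k) × Orient P → ℂ := star (dftC (torN P k) (Orient P)) *ᵥ mode p ψ with hFdef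
  have hhat : dftC (torN P k) (Orient P) *ᵥ F = mode p ψ := dftC_mulVec_star_mulVec' _
  have hL : star F ⬝ᵥ (tau1Matrix hd (P.eta k ^ P.d) c k *ᵥ F)
      = star ψ ⬝ᵥ (symb (torN P k) (Orient P) (tau1Matrix hd (P.eta k ^ P.d) c k) p *ᵥ ψ) := by
    rw [eq712 (torN P k) (Orient P) (tau1Matrix_isTranslInv hd hk _ c) F, hhat, Finset.sum_eq_single p]
    · have h1 : (fun i => mode p ψ (p, i)) = ψ := funext fun i => if_pos rfl
      rw [h1]
    · intro q _ hq
      have h0 : (fun i => mode p ψ (q, i)) = 0 := funext fun i => if_neg hq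
      rw [h0, Matrix.mulVec_zero, dotProduct_zero]
    · exact fun h => absurd (Finset.mem_univ p) h
  have hR : ∑ q : Tor (Mk P k), fibreMinU (P.L ^ k) (Mk P k) q (fun a => asym (dftC (Mk P k) (Orient P) *ᵥ F) (q, a))
      = fibreMinU (P.L ^ k) (Mk P k) p (asymO ψ) := by
    rw [show (dftC (Mk P k) (Orient P) *ᵥ F) = mode p ψ from hhat, Finset.sum_eq_single p]
    · congr 1
      funext a
      rw [asym_apply_eq_asymO]
      have hm : (fun o => mode p ψ (p, o)) = ψ := funext fun o => if_pos rfl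
      rw [hm]
    · intro q _ hq
      have h0 : (fun a => asym (mode p ψ) (q, a)) = 0 := by
        funext a
        rw [asym_apply_eq_asymO, Pi.zero_apply]
        have hm : (fun o => mode p ψ (q, o)) = fun _ => 0 := funext fun o => if_neg hq
        rw [hm, asymO_zero, Pi.zero_apply]
      rw [h0, fibreMinU_zero]
    · exact fun h => absurd (Finset.mem_univ p) h
  rw [← hL, form_tau1Matrix_eq_half_sum_fibreMinU hd hk hc, hR]

end Torus

end

end Literature.MathematicalPhysics.QuantumFieldTheory.BalabanImbrieJaffe1984to88.BIJ85Eq7117Tau1Symbol
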